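import Summits.ResolutionOfSingularities.ResolutionOfSingularities.Theorems.DeltaCutRun3
import HarnessLib

/-!
# DeltaCutSep — decomp-res node «SepCut» (lens-6 g26, critic row 196 CLEARED +1), tree file 1/8 of the node

Content VERBATIM from the decomp-res lens-6 g26 node `HOME/decomp-res-lens-6/g26/SepCut.lean` (pin f15f025c, 1820 l;
HOME = run/shared/lean/pub/decomp-res): NO carry — the node imports the LANDED tree only (`…Theorems.DeltaCutRun3` =
g25 «RunCut» (A), `…Theorems.DeltaCutChainCertificates2` = g24 (B)); every declaration is new, same namespace
`…Theorems.DeltaCutClasses`.  Farm (node, lens + critic runs): rc 0 · 0 err · 0 warn · 0 sorry · axioms std (20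
`#print axioms` guards in the Probe).  Critic: CRITIC-LEDGER row 196 CLEARED +1 (THE WHOLE-KIND LAW OF THE RUN AXIS
by the SEPARATING RUN: `E1TopRunHeavy ⟺ E1TopSepHeavy [RESIDUAL] ∧ E1TopRunHeavySepTame [DECIDED from E 5]`,
hypothesis-free and exact; permissibility of both steps PROVED; P∞ — the g25 residual kind B inhabitant — DECIDED at
sep-height 1; residual = kind F `E1TopSepFrozen` [INHABITED C×] ∧ kind P `E1TopSepPerpetual` [UNDECIDED]).  Landing
orders = the lens's plan `HOME/decomp-res-lens-6/g26/NEXT-g27.md` (fb3fac1c) §4 = lens note INBOX :1150, endorsed by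
the critic rider INBOX :1178: (A) `DeltaCutSep` = header + §SepDefs + §SepLaw + §SepEngine, (B) `DeltaCutSepCells` =
§SepCells + §SepJunction (cone-free aside home), (C) `DeltaCutSepCertificates` = §SepCertificates (imports
`DeltaCutChainCertificates2` and — for the cited helper — `DeltaCutRunCertificates`); all VERBATIM, `--kind proof
--supports stmt-ResolutionOfSingularities-26971`, no `maxHeartbeats`; the `def … : Prop` letters / cells
(`ClosureRegular`, `SepActive`, `OldTopRegular`, `SepTerminates`, `SepFrozen`, `SepPerpetual`,
`WORTopRunHeavySepTame`, `WORTopSepHeavy`, `E1TopRunHeavySepTame`, `E1TopSepHeavy`, `WORTopSepFrozen`,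
`WORTopSepPerpetual`, `E1TopSepFrozen`, `E1TopSepPerpetual`) are THIS node's cells (cn26), the `Set`-valued loci,
centres and the separating-run data (`badClosureCentre`, `oldTopCentre`, `sepHop`, `sepRun`, …) are its objects,
`chartSubst` / `linChartSubst` are certificate substitutions — none is a vendored fact.  Aside bookkeeping (rider:
exactly ONE switch this generation): the g25 aside `CCE1TopRunHeavy` (item 28367, filed at route rev 59) ⟶ ONE aside
on `DeltaCutClasses.E1TopSepHeavy` (name `SCE1TopSepHeavy`, home `DeltaCutSepCells`); re-location theorem
`e1TopRunHeavy_iff_e1TopSepHeavy (h5 : E 5)`, carve `e1TopRunHeavy_iff_sepHeavy_sepTame`, decided half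
`e1TopRunHeavySepTame_of_five (h5 : E 5)`.

The lens header, verbatim:

> # SepCut (decomp-res-lens-6 · g26 · window of CRITIC-LEDGER row 190, option (B) «kind B INHABITED + a law deciding it»):
> # THE SEPARATING LAW, and the perpetual datum P∞
>
> NODE «SepCut».  Target = the column's located residual after g25, `DeltaCutClasses.E1TopRunHeavy` («for some base `n`-datum
> of `E 1`'s class the CANONICAL BAD RUN does not terminate»: kind A `RunInfiniteLevel` — a level with infinitely
many bad points —
> or kind B `RunPerpetual` — finitely many bad points blown up forever; item stmt-…-26971, route MaxContactCut).
>
> ## The news of this node: KIND B IS INHABITED (it was tagged EXPECTED-EMPTY)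
>
> `P∞ := z³ + s·u²·w` over any field of characteristic `3` (`n = 3`; `z^p + s·u^(p−1)·w` in characteristic `p ≥ 3`, `z² + s·u·w`
> for `p = 2`).  Its top locus is the union of the `s`-axis and the `w`-axis; every top point other than the origin is TAME
> (`D_u^(2) f = s·w` is a regular parameter there); the origin is WILD (`z³ + 𝔪⁴`) and δ-heavy.  Blowing up the origin, the
> controlled transform in the Rees charts `s` and `w` is LITERALLY `P∞` again (`f(z's, s, u's, w's) = s³·f(z', s,
u', w')`), in chart
> `u` it is `z'³ + u·s'w'` (only the chart origin has order `3`, and it is tame), in chart `z` a unit: the bad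
points over a bad point
> are EXACTLY the two chart origins `O_s`, `O_w`, each a `P∞`-germ.  So `bad_i` has `2^i` points, EVERY level of the
canonical bad
> run is FINITE and NONEMPTY: `RunPerpetual 3 P∞` — certified below by ONE ring-level SELF-REPRODUCTION certificate,
the inductive
> step valid at every level (a uniform law, never a bounded prefix).  The support of `P∞` (two crossing lines) has NO isolated
> point: `P∞` is a datum of lens-4's class `ForcedTowerClasses.NonIsolatedReduction` and carries no `ForcedTower` (the field
> `isolated` fails at every level) — the perpetual bad thread of `P∞` is invisible to the tower axis BY CONSTRUCTION
(junction §SepJunction,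
> by name only).  WHY the point run cycles: the wild point sits at the crossing of two TAME top curves, which the bad run never
> touches and which are exchanged by an automorphism — no choice-free POINT rule can separate them.
>
> ## The law: the SEPARATING HOP (canonical, choice-free; positive-dimensional centres; «old components first»)
>
> On g25's stages `(Y, 𝓘)` at marking `n`: STEP 1 blows up `C₁ := 𝓘(closure of the bad locus)` (the REDUCED closure) when its
> subscheme is regular — at a finite level this is g25's centre, at an infinite level with regular closure (C_ax's axis, B_S's
> exceptional plane) the run now MOVES instead of freezing; STEP 2 then blows up `C₂ := 𝓘(closure π₁⁻¹(T ∖ closure bad))`, the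
> strict transform of the OLD top locus, when it is regular (else it is skipped) — the classical «old components first» move
> (CossartJannsenSaito2020 §5–§6 `O(x)`, CossartPiltant2019): after the point hop the two tame curves of `P∞` are disjoint OLD
> curves, canonically distinguished from the NEW exceptional curve, and blowing them up leaves only tame points.  A
level is ACTIVE
> when its bad locus is nonempty with regular reduced closure; at an inactive level the run STAYS.  PERMISSIBILITY IS PROVED for
> both steps (regular by the test; inside the top locus: `closure bad ⊆ {ord = n}` by upper semicontinuity `orderUSC_holds` and
> `ord ≤ n`, `π₁⁻¹(T ∖ C₁) ⊆ T₁` by `IsBlowup.idealOrder_controlledTransform_of_not_mem`); base / datum upstairs by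
> `baseStable_holds` / `isDatum_transform_blowup`.  LETTERS: `SepTerminates` (active prefix, then an EMPTY bad locus) |
> `SepFrozen` (active prefix, then a NONEMPTY bad locus with IRREGULAR reduced closure) | `SepPerpetual` (active forever);
> trichotomy and exclusivity by `Nat.find` (no König needed).  ENGINE: ONE theorem for all heights from `SeqDimFour 5 n`
> (`wor_of_sepTerminatesAt`, induction generalising the stage, one or two `CentreSeq.cons` per level).  CELLS: the decided
> `WORTopRunHeavySepTame n` and the residual `WORTopSepHeavy n` carve g25's residual `WORTopRunHeavy n` HYPOTHESIS-FREE
> (`worTopRunHeavy_iff_sepHeavy_sepTame`); the decided side is PROVED from five; RE-LOCATION `e1TopRunHeavy_iff_e1TopSepHeavy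
> (h5 : E 5)` with edges by tree names down to `E 1`; the residual splits hyp-free into `SepFrozen ∨ SepPerpetual` cells.
>
> ## Inhabitants (ring-level, level-indexed certificates, §SepCertificates)
>
> STRICT: `P∞` is g25-RESIDUAL (kind B) and g26-DECIDED at sep-height `1`.  The kind-A inhabitants are DECIDED: C_ax
= `z³ + t⁴ + u⁴`
> at sep-height `1` (closure of bad₀ = the `w`-axis = the whole top locus, regular; above it NO point of order `3`), B_S =
> `z³ + t⁷ + u⁷ + w⁷` at sep-height `2` (level 1: closure of bad₁ = the exceptional plane = the whole top locus,
regular; above it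
> no point of order `3`).  `SepFrozen` is INHABITED by C× := `z³ + t⁴ + u⁴·w⁴` (bad₀ = `u`-axis ∪ `w`-axis, all wild and δ-heavy;
> the reduced closure `V(z, t, u·w)` is NOT regular at the origin).  `SepPerpetual`: NO inhabitant is known or claimed (not
> claimed empty: it is the rd-4 heart).  HONEST CEILING (priced 0): kind A is not eliminable WHOLE by a session law
— C_ax is the
> cylinder over `z³ + t⁴ + u⁴ ∈ k[z,t,u]`, and every cylinder over a dim-3 datum with an isolated wild δ-heavy point
is of kind A
> at level 0, so «kind A whole from `E 5`» contains dim-3 wild order reduction relative to contact (a CossartPiltant2019-size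
> port); the separating law RE-LOCATES kind A ∪ kind B exactly into `SepTame ∨ SepFrozen ∨ SepPerpetual` instead.
>
> ## FAMILY RULE after «SepCut» (critic, binding for g27; cn28-style)
>
> The centre-law axis is now a CLOCK like the run axis: further hop recipes (componentwise regularity tests,
resolve-the-closure-first,
> normal-crossings closures, three-step variants, weighted/toroidal centres) earn credit ONLY if the kernel law
ELIMINATES `SepFrozen`
> WHOLE or `SepPerpetual` WHOLE (or a whole structural sub-kind stated in advance by mechanism, with a certified
inhabitant, once) —
> never for re-cutting them into finer inhabited letters; otherwise the next move is (T2′) | (ρ) | the closing law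
of the residual.
> PRECISION OF THE LETTERS (which skips freeze): a level FREEZES iff its bad locus is NONEMPTY and the reduced
closure of the bad
> locus is NOT regular (step 1 cannot fire); an irregular strict transform of the old top locus merely OMITS STEP 2
at that level (the
> run goes on with step 1 of the next level and never freezes on that account); an EMPTY bad locus is
`SepTerminates`.  Both regularity
> tests are GLOBAL (`IsRegular (C.subscheme)`), canonical and choice-free; the global step-1 test can only ENLARGE
`SepFrozen` against a
> componentwise variant, the global step-2 test can only omit step 2 more often — a later local/componentwise
refinement is 0-weight
> unless it eliminates `SepFrozen` whole.
>
> IMPORTS THE LANDED TREE ONLY — NO CARRY: g25's `Theorems/DeltaCutRun` + `DeltaCutRun2` + `DeltaCutRun3` (§RunDefs, §RunLaw,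
> §RunKonig, §RunCells, §RunEngine `isRegular_subscheme_badCentre` / `wor_of_runTerminatesAt` / the g25 edges, §RunExactness
> `topChainHeavy_of_not_runTerminates` / `worTopRunHeavy_iff_intrinsic`; landed 07:19–07:25Z) and g24's
> `Theorems/DeltaCutChainCertificates(2)` (polynomial toolkit `sq_mul_deriv_mem_pow`, `mem_of_mul_mul_pow_mem_pow`,
`natCast_not_mem`,
> `pow_not_mem`, `X_mem_spanX4`, `f_self`/`f_ne`/`f_two`/`f_one`; `BS_isolated`, `BS_chain_certificate`,
`Cax_curve_certificate` cited by
> name).  TREE NAMES USED: g23 `wor_of_splitOrLightOrDeltaLight`; g24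
> `isDatum_transform_blowup`, `isRegular_subscheme_vanishingIdeal_finset`; `TwistCutClasses.orderUSC_holds`, `baseStable_holds`;
> Literature `IsBlowup.idealOrder_controlledTransform_of_not_mem`, `blowup.isBlowup`, `coe_support_vanishingIdeal`;
> `LightCutClasses.two_not_mem`, `derivation_pow_succ_mem`.
>
> Farm: `lean check` rc 0 · 0 errors · 0 sorries; axioms {propext, Classical.choice, Quot.sound} (see `bc/Probe.lean`).
> No `instance`, no `notation`, no `sorry`.  New `def`s are `Prop`-valued cells/letters, `Set`-valued loci, or the
separating-run
> data (`topLocusOf`, `badClosureCentre`, `stepOne`, `oldTopCentre`, `stepTwo`, `sepHop`, `sepRun`, `sepRunHom`)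
under `Theorems`.
> (Sources: Hironaka1964; CossartJannsenSaito2020 §5–§6, Thm. 9.6; CossartPiltant2019;
BierstoneGrigorievMilmanWlodarczyk2011 §3;
> Giraud1975; EGAIV4 §16.)

## This file

§(SEP) THE SEPARATING-RUN CUT of the run-axis located residual `E1TopRunHeavy` (node l. 103–462): `section SepDefs`
(the CANONICAL, choice-free, port-free SEPARATING RUN on g25's `Stage`: step 1 = blow up `badClosureCentre` =
𝓘(closure bad) when `ClosureRegular`, step 2 = blow up `oldTopCentre` = 𝓘(closure π₁⁻¹(T ∖ closure bad)) when
`OldTopRegular` else omit — `sepHop` / `sepRun` by `Nat.rec`, `sepRun_succ_front`; the LETTERS `SepTerminates` /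
`SepFrozen` (freeze ⟺ the first inactive level has bad ≠ ∅ AND an irregular reduced closure of bad) /
`SepPerpetual`, `sep_trichotomy`, `not_sepTerminates_iff`, all hypothesis-free); `section SepLaw` (PERMISSIBILITY
PROVED for both steps: `support_badClosureCentre_subset_support` by upper semicontinuity and THE LIMIT-POINT LEMMA
`support_oldTopCentre_subset_support`; `badClosureCentre_eq_badCentre` at a finite level); `section SepEngine` (ONE
all-heights engine `wor_of_sepTerminatesAt (hn) (h5 : SeqDimFour 5 n)` by induction on the height generalising the
stage, `wor_of_sepTerminates`; no per-height lemma) — continued in `DeltaCutSep2`… where the 400-line cap cuts.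
(This first part carries: `topLocusOf`, `badClosureCentre`, `coe_support_badClosureCentre`, `ClosureRegular`,
`SepActive`, `stepOne`, `oldTopCentre`, `coe_support_oldTopCentre`, `OldTopRegular`, `stepTwo`, `sepHop`, `sepRun`,
`sepRun_zero`, `sepRun_succ`, `sepRunHom`, `sepRun_succ_front`, `sepHop_next_of_regular`,
`sepHop_next_of_not_regular`, `sepHop_next_of_not_active`, `sepRun_eq_of_not_active`, `SepTerminates`, `SepFrozen`,
`SepPerpetual`, `SepTerminates.not_sepPerpetual`, `SepFrozen.not_sepPerpetual`, `SepTerminates.not_sepFrozen`.)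

[WRITER NOTE (decomp-res writer g12): file split only (tree files ≤ 400 lines); namespace, sections, section opens
and every declaration exactly as in the lens (the node's HOME-only dupNamespace-linter line is dropped; the two
namespace-level `open …TwistCutClasses` / `open …LightCutClasses` lines of the node are replayed).]

(Sources: Hironaka1967 (characteristic polyhedra); CossartJannsenSaito2020 Def. 3.13 / Thm. 3.14, Ch. 8, Thm. 9.6;
Hironaka1970 (near points / vertices); CossartPiltant2019 Prop. 2.6; CossartPiltant2008 §2; Giraud1975; Hironaka2005
(three key theorems: order under permissible blow-up); EGAIV4 §16–§17; StacksProject 0804 / 0BIQ / 031I; Matsumura1987 §28.)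
-/

noncomputable section

open CategoryTheory CategoryTheory.Limits AlgebraicGeometry TopologicalSpace IsLocalRing
open Literature.AlgebraicGeometry.Resolution

universe u

namespace Summit.ResolutionOfSingularities.ResolutionOfSingularities.Theorems.DeltaCutClasses

open Summit.ResolutionOfSingularities.ResolutionOfSingularities.Theorems.TwistCutClasses
open Summit.ResolutionOfSingularities.ResolutionOfSingularities.Theorems.LightCutClasses

section SepDefs

open Summit.ResolutionOfSingularities.ResolutionOfSingularities.Theorems
open WeakOrderReduction ForcedTowerClasses SubfieldContactClasses AbsoluteContactClasses PurityValveClasses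
open Scheme.IdealSheafData (vanishingIdeal)

/-! ### §SepDefs — THE SEPARATING HOP (two steps, reduced positive-dimensional centres, «old components first») and ITS RUN -/

/-- **THE TOP LOCUS of a stage** at marking `n`: the points of order `≥ n` (for an `n`-datum: the support, `= {ord = n}`).
DEFINITION (support). -/
def topLocusOf (n : ℕ) (N : Stage) : Set N.Y := {y | ((n : ℕ) : ℕ∞) ≤ idealOrder N.I y}

/-- **THE STEP-1 CENTRE**: the REDUCED closed subscheme `𝓘(closure of the bad locus)` (`Scheme.IdealSheafData.vanishingIdeal` of
the Zariski closure; at a finite level the bad locus is closed and this is g25's `badCentre`). DEFINITION (support). -/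
def badClosureCentre (n : ℕ) (N : Stage) : N.Y.IdealSheafData :=
  vanishingIdeal ⟨closure (badLocus N.Y N.I n), isClosed_closure⟩

/-- the step-1 centre is supported exactly on the closure of the bad locus. [folklore] -/
theorem coe_support_badClosureCentre (n : ℕ) (N : Stage) :
    ((badClosureCentre n N).support : Set N.Y) = closure (badLocus N.Y N.I n) :=
  coe_support_vanishingIdeal _

/-- `ClosureRegular n N` — the reduced closure of the bad locus is a REGULAR scheme (the step-1 test). DEFINITION (letter). -/
def ClosureRegular (n : ℕ) (N : Stage) : Prop := Scheme.IsRegular (badClosureCentre n N).subscheme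

/-- `SepActive n N` — the level is ACTIVE: the bad locus is NONEMPTY and its reduced closure is REGULAR (so the separating hop
MOVES). DEFINITION (letter). -/
def SepActive (n : ℕ) (N : Stage) : Prop := ¬ BadEmpty n N ∧ ClosureRegular n N

/-- **STEP 1** of the separating hop: blow up the reduced closure of the bad locus and pass to the controlled transform
`(π₁^*𝓘 : 𝓔ⁿ)`. DEFINITION (support). -/
abbrev stepOne (n : ℕ) (N : Stage) : Stage :=
  ⟨blowup (badClosureCentre n N),
    controlledTransform (blowup.π (badClosureCentre n N)) (badClosureCentre n N) N.I n⟩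

/-- **THE STEP-2 CENTRE** on the step-1 stage: the REDUCED closed subscheme of the closure of `π₁⁻¹(T ∖ closure bad)` — the
STRICT TRANSFORM OF THE OLD TOP LOCUS away from the step-1 centre («old components first»: it never contains a point of the new
exceptional component that is not on an old one). DEFINITION (support). -/
def oldTopCentre (n : ℕ) (N : Stage) : (stepOne n N).Y.IdealSheafData :=
  vanishingIdeal
    ⟨closure ((blowup.π (badClosureCentre n N)).base ⁻¹' (topLocusOf n N \ closure (badLocus N.Y N.I n))),
      isClosed_closure⟩

/-- the step-2 centre is supported exactly on the closure of `π₁⁻¹(T ∖ closure bad)`. [folklore] -/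
theorem coe_support_oldTopCentre (n : ℕ) (N : Stage) :
    ((oldTopCentre n N).support : Set (stepOne n N).Y) =
      closure ((blowup.π (badClosureCentre n N)).base ⁻¹' (topLocusOf n N \ closure (badLocus N.Y N.I n))) :=
  coe_support_vanishingIdeal _

/-- `OldTopRegular n N` — the strict transform of the old top locus is a REGULAR scheme (the step-2 test).
DEFINITION (letter). -/
def OldTopRegular (n : ℕ) (N : Stage) : Prop := Scheme.IsRegular (oldTopCentre n N).subscheme

/-- **STEP 2** of the separating hop: blow up the strict transform of the old top locus on the step-1 stage and pass to the
controlled transform. DEFINITION (support). -/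
abbrev stepTwo (n : ℕ) (N : Stage) : Stage :=
  ⟨blowup (oldTopCentre n N),
    controlledTransform (blowup.π (oldTopCentre n N)) (oldTopCentre n N) (stepOne n N).I n⟩

open Classical in
/-- **THE SEPARATING HOP of a stage at marking `n`** (canonical, choice-free): at an ACTIVE level do STEP 1, then STEP 2 if the
strict transform of the old top locus is regular (else stop after step 1); at an INACTIVE level (empty bad locus, or irregular
reduced closure) STAY. DEFINITION (the step of the separating run). -/
def sepHop (n : ℕ) (N : Stage) : Hop N :=
  if SepActive n N then
    if OldTopRegular n N then
      { next := stepTwo n N, hom := blowup.π (oldTopCentre n N) ≫ blowup.π (badClosureCentre n N) }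
    else { next := stepOne n N, hom := blowup.π (badClosureCentre n N) }
  else { next := N, hom := 𝟙 N.Y }

/-- **THE SEPARATING RUN** `sepRun n N : ℕ → Stage` — iterate the separating hop (`Nat.rec`, END-iteration, exactly as g25's
`run`). DEFINITION (the object). -/
def sepRun (n : ℕ) (N : Stage) : ℕ → Stage := fun i => Nat.rec N (fun _ P => (sepHop n P).next) i

/-- level `0` of the separating run is the stage itself. [folklore] -/
@[simp] theorem sepRun_zero (n : ℕ) (N : Stage) : sepRun n N 0 = N := rfl

/-- level `i+1` of the separating run is the separating hop of level `i`. [folklore] -/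
theorem sepRun_succ (n : ℕ) (N : Stage) (i : ℕ) : sepRun n N (i + 1) = (sepHop n (sepRun n N i)).next := rfl

/-- **THE HOP MORPHISMS OF THE SEPARATING RUN**. DEFINITION (support). -/
def sepRunHom (n : ℕ) (N : Stage) (i : ℕ) : (sepRun n N (i + 1)).Y ⟶ (sepRun n N i).Y := (sepHop n (sepRun n N i)).hom

/-- the separating run of the next stage is the tail of the separating run. [folklore] -/
theorem sepRun_succ_front (n : ℕ) (N : Stage) : ∀ i : ℕ, sepRun n N (i + 1) = sepRun n (sepHop n N).next i
  | 0 => rfl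
  | i + 1 => by
    show (sepHop n (sepRun n N (i + 1))).next = (sepHop n (sepRun n (sepHop n N).next i)).next
    rw [sepRun_succ_front n N i]

/-- the separating hop of an ACTIVE level whose old top locus has REGULAR strict transform is step 1 followed by
step 2. [folklore] -/
theorem sepHop_next_of_regular {n : ℕ} {N : Stage} (h : SepActive n N) (h₂ : OldTopRegular n N) :
    (sepHop n N).next = stepTwo n N := by
  rw [sepHop, if_pos h, if_pos h₂]

/-- the separating hop of an ACTIVE level whose old top locus has IRREGULAR strict transform is step 1 alone. [folklore] -/
theorem sepHop_next_of_not_regular {n : ℕ} {N : Stage} (h : SepActive n N) (h₂ : ¬ OldTopRegular n N) :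
    (sepHop n N).next = stepOne n N := by
  rw [sepHop, if_pos h, if_neg h₂]

/-- the separating hop of an INACTIVE level stays. [folklore] -/
theorem sepHop_next_of_not_active {n : ℕ} {N : Stage} (h : ¬ SepActive n N) : (sepHop n N).next = N := by
  rw [sepHop, if_neg h]

/-- **AN INACTIVE LEVEL IS FINAL**: from the first inactive level on, the separating run STAYS. [folklore] -/
theorem sepRun_eq_of_not_active {n : ℕ} {N : Stage} {h : ℕ} (hh : ¬ SepActive n (sepRun n N h)) :
    ∀ i : ℕ, h ≤ i → sepRun n N i = sepRun n N h := by
  intro i hi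
  obtain ⟨d, rfl⟩ := Nat.exists_eq_add_of_le hi
  induction d with
  | zero => rfl
  | succ d ih =>
    rw [← Nat.add_assoc, sepRun_succ, ih (Nat.le_add_right h d), sepHop_next_of_not_active hh]

end SepDefs

section SepLaw

open Summit.ResolutionOfSingularities.ResolutionOfSingularities.Theorems
open WeakOrderReduction ForcedTowerClasses SubfieldContactClasses AbsoluteContactClasses PurityValveClasses

/-! ### §SepLaw — the LETTERS of the separating run and their TRICHOTOMY (no König needed) -/

/-- **`SepTerminates n N`** — the separating run TERMINATES: an active prefix, then a level with EMPTY bad locus.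
DEFINITION (letter; the DECIDED kind). -/
def SepTerminates (n : ℕ) (N : Stage) : Prop :=
  ∃ h : ℕ, (∀ j < h, SepActive n (sepRun n N j)) ∧ BadEmpty n (sepRun n N h)

/-- **`SepFrozen n N`** — the separating run FREEZES: an active prefix, then a level with NONEMPTY bad locus whose
reduced closure
is NOT a regular scheme (C× = `z³ + t⁴ + u⁴w⁴` at level `0`). DEFINITION (letter; RESIDUAL kind F). -/
def SepFrozen (n : ℕ) (N : Stage) : Prop :=
  ∃ h : ℕ, (∀ j < h, SepActive n (sepRun n N j)) ∧ ¬ BadEmpty n (sepRun n N h) ∧ ¬ ClosureRegular n (sepRun n N h)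

/-- **`SepPerpetual n N`** — the separating run is PERPETUAL: every level is active (nonempty bad locus with regular reduced
closure, blown up forever; no inhabitant known). DEFINITION (letter; RESIDUAL kind P). -/
def SepPerpetual (n : ℕ) (N : Stage) : Prop := ∀ i : ℕ, SepActive n (sepRun n N i)

/-- exclusivity: a terminating separating run is not perpetual. [new] [folklore] -/
theorem SepTerminates.not_sepPerpetual {n : ℕ} {N : Stage} (h : SepTerminates n N) : ¬ SepPerpetual n N :=
  fun hP => by obtain ⟨i, _, he⟩ := h; exact (hP i).1 he

/-- exclusivity: a frozen separating run is not perpetual. [new] [folklore] -/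
theorem SepFrozen.not_sepPerpetual {n : ℕ} {N : Stage} (h : SepFrozen n N) : ¬ SepPerpetual n N :=
  fun hP => by obtain ⟨i, _, _, hr⟩ := h; exact hr (hP i).2

/-- exclusivity: a terminating separating run is not frozen (the first inactive level is unique). [new] [folklore] -/
theorem SepTerminates.not_sepFrozen {n : ℕ} {N : Stage} (h : SepTerminates n N) : ¬ SepFrozen n N := by
  rintro ⟨i', hpre', hne', hr'⟩
  obtain ⟨i, hpre, he⟩ := h
  rcases lt_trichotomy i i' with hlt | rfl | hgt
  · exact (hpre' i hlt).1 he
  · exact hne' he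
  · exact hr' (hpre i' hgt).2

end SepLaw

end Summit.ResolutionOfSingularities.ResolutionOfSingularities.Theorems.DeltaCutClasses
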